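import Summits.Ventures.PercRepro.ProfilePointedCircuitClassesStarSharpD0P

/-!
# PercRepro — CASE D0 OF `StarNineSharp`, PART Q: THE RULE R4a′ WITH AN EXISTENTIAL POINT `w`
(p5, gen 54; `proofs/P5-GM1.md` §81 ADD 1–3)

Regime (i): no ON line through `e`, an ON plane through `e, f` allowed. A demand `π + e + b` on an `ef`-plane
(`¬ d0c1`) whose swap fails (`¬ d0c0`) goes, when some `w ∈ X ∖ π` off the plane of `π + e` makes `π + w` an OFF
triple whose complementary pair `ρ′ = X − π − w` is not an ON demand (`d0c4'`), to the bi-basis `ρ′ + e + f`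
(`d0_injR4a'`); the bi-bases whose pair IS an ON demand are the images of the rule R2′ (`d0_injR2''`). The two
sub-classes of the bi-basis target kind are told apart by the predicate «`insert b (B.erase f)` is an ON demand».
-/

open scoped Matroid

namespace PercRepro.Cogirth

open Finset ThmH Skew Shadow Profile

open Classical

variable {α : Type} [DecidableEq α] {N : Matroid α} [N.Finite]

section StarSharpD0Q

variable {b b' : α}

/-- Condition R4a′: some `w ∈ X ∖ π` off the plane of `π + e` makes `π + w` an OFF triple (`ρ(π + w + b + b′) = 5`)
with `(X − π − w) + e + f` of rank 4 and the pair `X − π − w` not an ON demand. -/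
def d0c4' (N : Matroid α) [N.Finite] (b b' e f : α) (W : Finset α) : Prop :=
  ∃ w ∈ ((((gr N).erase b).erase b').erase f).erase e \ (W.erase b).erase e,
    rk N (insert w (insert e ((W.erase b).erase e))) = 4 ∧
    rk N (insert b (insert b' (insert w ((W.erase b).erase e)))) = 5 ∧
    rk N (insert f (insert e ((((((gr N).erase b).erase b').erase f).erase e \ (W.erase b).erase e).erase w))) = 4 ∧
    ¬ (insert b (insert e ((((((gr N).erase b).erase b').erase f).erase e \ (W.erase b).erase e).erase w)) ∈ biIndepSets N 4 ∧
      rk N (insert b (insert b' (insert e ((((((gr N).erase b).erase b').erase f).erase e \ (W.erase b).erase e).erase w)))) = 4)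

/-- The point `w` of R4a′ (a witness of `d0c4'`; `e` when there is none). -/
noncomputable def r4aW (N : Matroid α) [N.Finite] (b b' e f : α) (W : Finset α) : α :=
  if h : d0c4' N b b' e f W then h.choose else e

/-- `E₇ ∖ ((X − π − w) + e + f) = π + w` for `π ⊆ X` and `w ∈ X ∖ π`. -/
theorem E7_sdiff_insert_ef_erase_eq {e f : α} {π : Finset α} {w : α}
    (hπ : π ⊆ ((((gr N).erase b).erase b').erase f).erase e)
    (hw : w ∈ ((((gr N).erase b).erase b').erase f).erase e) :
    ((gr N).erase b).erase b' \ insert f (insert e ((((((gr N).erase b).erase b').erase f).erase e \ π).erase w)) =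
      insert w π := by
  have hwE : w ∈ ((gr N).erase b).erase b' := (erase_subset _ _).trans (erase_subset _ _) hw
  have hwe : w ≠ e := (mem_erase.1 hw).1
  have hwf : w ≠ f := (mem_erase.1 (mem_erase.1 hw).2).1
  ext x
  simp only [mem_sdiff, mem_insert, mem_erase, not_or, not_and, not_not]
  constructor
  · rintro ⟨⟨hxb', hxb, hxg⟩, hxf, hxe, hx⟩
    by_cases hxw : x = w
    · exact Or.inl hxw
    · exact Or.inr (hx hxw ⟨hxe, hxf, hxb', hxb, hxg⟩)
  · rintro (rfl | hxπ)
    · exact ⟨⟨(mem_erase.1 hwE).1, (mem_erase.1 (mem_erase.1 hwE).2).1, (mem_erase.1 (mem_erase.1 hwE).2).2⟩,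
        hwf, hwe, fun h' => absurd rfl h'⟩
    · have hxX := hπ hxπ
      have hxE : x ∈ ((gr N).erase b).erase b' := (erase_subset _ _).trans (erase_subset _ _) hxX
      refine ⟨⟨(mem_erase.1 hxE).1, (mem_erase.1 (mem_erase.1 hxE).2).1, (mem_erase.1 (mem_erase.1 hxE).2).2⟩,
        (mem_erase.1 (mem_erase.1 hxX).2).1, (mem_erase.1 hxX).1, fun _ _ => hxπ⟩

/-- `ρ(π + e + f) = 3` for an ON demand on an `ef`-plane (`¬ d0c1`). -/
theorem rk_insert_ef_eq_three_of_not_c1 {e f : α} (he : e ∈ gr N) (hf : f ∈ gr N)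
    {π : Finset α} (hπ : π ⊆ ((((gr N).erase b).erase b').erase f).erase e) (hYr : rk N (insert e π) = 3)
    (hnc₁ : ¬ rk N (insert f (insert e π)) = 4) : rk N (insert f (insert e π)) = 3 := by
  have hXg : ((((gr N).erase b).erase b').erase f).erase e ⊆ gr N :=
    (erase_subset _ _).trans ((erase_subset _ _).trans ((erase_subset _ _).trans (erase_subset _ _)))
  have h1 := rk_insert_le_add_one (N := N) hf (insert_subset he (hπ.trans hXg))
  have h2 : rk N (insert e π) ≤ rk N (insert f (insert e π)) := rk_mono' (M := N) (subset_insert _ _)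
  omega

/-- **RULE R4a′ IS INJECTIVE** into the bi-bases `B ∋ e, f` (`b, b′ ∉ B`) whose pair `B − e − f` is NOT an ON demand
(regime (i): no ON line through `e`). Two demands with the same image have `π₁ + w₁ = π₂ + w₂`, so `w₁ ∈ π₂` lies
on the `ef`-plane of `π₂ + e`, which meets the `ef`-plane of `π₁ + e` in the line `ef` — an ON line through `e`
by F1″ unless the two planes coincide, and then `w₁` is on the plane of `π₁ + e`, against `d0c4'`. -/
theorem d0_injR4a' (hn : (gr N).card = 9) (hR : rk N (gr N) = 5) (h : SeriesPair N b b')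
    {e f : α} (he : e ∈ gr N) (hf : f ∈ gr N) (hef : e ≠ f) (heb : e ≠ b) (heb' : e ≠ b') (hfb : f ≠ b) (hfb' : f ≠ b')
    (hE7 : rk N (((gr N).erase b).erase b') = 4)
    (hnle : ∀ S : Finset α, S ⊆ ((gr N).erase b).erase b' → e ∈ S → rk N (insert b (insert b' S)) ≤ 3 → rk N S ≤ 1)
    (hef2 : rk N {e, f} = 2) :
    ((d0DON N b' e f).filter (fun W => (¬ d0c0 N b b' e f W ∧ ¬ d0c1 N b e f W) ∧ d0c4' N b b' e f W)).card ≤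
      ((biIndepSets N 4).filter (fun B => ((f ∈ B ∧ b' ∉ B) ∧ (e ∈ B ∧ b ∉ B)) ∧
        ¬ (insert b (B.erase f) ∈ biIndepSets N 4 ∧ rk N (insert b (insert b' (B.erase f))) = 4))).card := by
  have hb : b ∈ gr N := h.1; have hb' : b' ∈ gr N := h.2.1; have hbb' : b ≠ b' := h.2.2.1
  have hXE : ((((gr N).erase b).erase b').erase f).erase e ⊆ ((gr N).erase b).erase b' :=
    (erase_subset _ _).trans (erase_subset _ _)
  have heE : e ∈ ((gr N).erase b).erase b' := mem_erase.2 ⟨heb', mem_erase.2 ⟨heb, he⟩⟩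
  have hfE : f ∈ ((gr N).erase b).erase b' := mem_erase.2 ⟨hfb', mem_erase.2 ⟨hfb, hf⟩⟩
  have heX : e ∉ ((((gr N).erase b).erase b').erase f).erase e := fun h' => (mem_erase.1 h').1 rfl
  have hfX : f ∉ ((((gr N).erase b).erase b').erase f).erase e := fun h' => (mem_erase.1 (mem_erase.1 h').2).1 rfl
  have hE7c : (((gr N).erase b).erase b').card = 7 := by
    rw [card_erase_of_mem (mem_erase.2 ⟨hbb'.symm, hb'⟩), card_erase_of_mem hb, hn]
  have hXc : (((((gr N).erase b).erase b').erase f).erase e).card = 5 := by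
    rw [card_erase_of_mem (mem_erase.2 ⟨hef, heE⟩), card_erase_of_mem hfE, hE7c]
  have hdata := d0_demand_data h hn hf hef heb hfb hfb' (e := e)
  set X := ((((gr N).erase b).erase b').erase f).erase e with hXdef
  -- the data of a demand of the class, with its chosen point `w`
  have hcls : ∀ W ∈ biIndepSets N 4, ((e ∈ W ∧ f ∉ W) ∧ b' ∉ W) → ¬ (gr N \ W).erase b' ∈ biIndepSets N 4 →
      d0c4' N b b' e f W →
      r4aW N b b' e f W ∈ X ∧ r4aW N b b' e f W ∉ (W.erase b).erase e ∧
        rk N (insert (r4aW N b b' e f W) (insert e ((W.erase b).erase e))) = 4 ∧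
        rk N (insert b (insert b' (insert (r4aW N b b' e f W) ((W.erase b).erase e)))) = 5 ∧
        rk N (insert f (insert e ((X \ (W.erase b).erase e).erase (r4aW N b b' e f W)))) = 4 ∧
        ¬ (insert b (insert e ((X \ (W.erase b).erase e).erase (r4aW N b b' e f W))) ∈ biIndepSets N 4 ∧
          rk N (insert b (insert b' (insert e ((X \ (W.erase b).erase e).erase (r4aW N b b' e f W))))) = 4) := by
    intro W _ _ _ hc4
    simp only [r4aW, dif_pos hc4]
    obtain ⟨hw, h1, h2, h3, h4⟩ := hc4.choose_spec
    exact ⟨(mem_sdiff.1 hw).1, (mem_sdiff.1 hw).2, h1, h2, h3, h4⟩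
  apply card_le_card_of_injOn (fun W => insert f (insert e ((X \ (W.erase b).erase e).erase (r4aW N b b' e f W))))
  · intro W hW
    simp only [d0DON, mem_coe, mem_filter] at hW
    obtain ⟨⟨hWs, hPD, hcW⟩, -, hc4⟩ := hW
    obtain ⟨hbW, hπX, hπ2, hYeq, hWeq, hYr, hYc, hYon⟩ := hdata W hWs hPD hcW
    obtain ⟨hwX, hwπ, hw4, hw5, hB4, hnd⟩ := hcls W hWs hPD hcW hc4
    set w := r4aW N b b' e f W with hwdef
    set π := (W.erase b).erase e with hπdef
    set ρ := (X \ π).erase w with hρdef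
    have hwe : w ≠ e := fun h' => heX (h' ▸ hwX)
    have hwf : w ≠ f := fun h' => hfX (h' ▸ hwX)
    have hρX : ρ ⊆ X := (erase_subset _ _).trans sdiff_subset
    have heρ : e ∉ ρ := fun h' => heX (hρX h')
    have hfρ : f ∉ ρ := fun h' => hfX (hρX h')
    have hfeρ : f ∉ insert e ρ := by
      simp only [mem_insert, not_or]; exact ⟨hef.symm, hfρ⟩
    have hρc : ρ.card = 2 := by
      rw [hρdef, card_erase_of_mem (mem_sdiff.2 ⟨hwX, hwπ⟩), card_sdiff_of_subset hπX, hXc, hπ2]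
    have hBE : insert f (insert e ρ) ⊆ ((gr N).erase b).erase b' :=
      insert_subset hfE (insert_subset heE (hρX.trans hXE))
    have hB4c : (insert f (insert e ρ)).card = 4 := by
      rw [card_insert_of_notMem hfeρ, card_insert_of_notMem heρ, hρc]
    have hBf : (insert f (insert e ρ)).erase f = insert e ρ := erase_insert hfeρ
    simp only [mem_coe, mem_filter]
    refine ⟨?_, ⟨⟨mem_insert_self _ _, ?_⟩, mem_insert_of_mem (mem_insert_self _ _), ?_⟩, ?_⟩
    · rw [mem_biIndepSets_iff_of_subset_E7 h hn hBE hB4c, E7_sdiff_insert_ef_erase_eq hπX hwX]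
      exact ⟨hB4, hw5⟩
    · intro h'
      rcases mem_insert.1 h' with h2 | h2
      · exact hfb' h2.symm
      · rcases mem_insert.1 h2 with h3 | h3
        · exact heb' h3.symm
        · exact (mem_erase.1 (hXE (hρX h3))).1 rfl
    · intro h'
      rcases mem_insert.1 h' with h2 | h2
      · exact hfb h2.symm
      · rcases mem_insert.1 h2 with h3 | h3
        · exact heb h3.symm
        · exact (mem_erase.1 (mem_erase.1 (hXE (hρX h3))).2).1 rfl
    · rw [hBf]; exact hnd
  · intro W₁ hW₁ W₂ hW₂ heq
    simp only [d0DON, mem_coe, mem_filter] at hW₁ hW₂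
    obtain ⟨hb₁, hπ₁, hπ2₁, hYeq₁, hWeq₁, hYr₁, hYc₁, hYon₁⟩ := hdata W₁ hW₁.1.1 hW₁.1.2.1 hW₁.1.2.2
    obtain ⟨hb₂, hπ₂, hπ2₂, hYeq₂, hWeq₂, hYr₂, hYc₂, hYon₂⟩ := hdata W₂ hW₂.1.1 hW₂.1.2.1 hW₂.1.2.2
    obtain ⟨hw₁X, hw₁π, hw₁4, -, -, -⟩ := hcls W₁ hW₁.1.1 hW₁.1.2.1 hW₁.1.2.2 hW₁.2.2
    obtain ⟨hw₂X, hw₂π, -, -, -, -⟩ := hcls W₂ hW₂.1.1 hW₂.1.2.1 hW₂.1.2.2 hW₂.2.2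
    have hnc₁₁ : ¬ rk N (insert f (insert e ((W₁.erase b).erase e))) = 4 := hW₁.2.1.2
    have hnc₁₂ : ¬ rk N (insert f (insert e ((W₂.erase b).erase e))) = 4 := hW₂.2.1.2
    set w₁ := r4aW N b b' e f W₁ with hw₁def
    set w₂ := r4aW N b b' e f W₂ with hw₂def
    set π₁ := (W₁.erase b).erase e with hπ₁def
    set π₂ := (W₂.erase b).erase e with hπ₂def
    have heπ₁ : e ∉ π₁ := fun h' => heX (hπ₁ h')
    have heπ₂ : e ∉ π₂ := fun h' => heX (hπ₂ h')
    -- the two complementary pairs agree, hence `π₁ + w₁ = π₂ + w₂`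
    have hρ : (X \ π₁).erase w₁ = (X \ π₂).erase w₂ := by
      have heq' : insert f (insert e ((X \ π₁).erase w₁)) = insert f (insert e ((X \ π₂).erase w₂)) := heq
      have h1 : ((insert f (insert e ((X \ π₁).erase w₁))).erase f).erase e =
          ((insert f (insert e ((X \ π₂).erase w₂))).erase f).erase e := by rw [heq']
      have hfe : ∀ ρ ⊆ X, f ∉ insert e ρ := by
        intro ρ hρ; simp only [mem_insert, not_or]; exact ⟨hef.symm, fun h' => hfX (hρ h')⟩
      have hee : ∀ ρ ⊆ X, e ∉ ρ := fun ρ hρ h' => heX (hρ h')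
      have hs₁ : (X \ π₁).erase w₁ ⊆ X := (erase_subset _ _).trans sdiff_subset
      have hs₂ : (X \ π₂).erase w₂ ⊆ X := (erase_subset _ _).trans sdiff_subset
      rwa [erase_insert (hfe _ hs₁), erase_insert (hfe _ hs₂), erase_insert (hee _ hs₁),
        erase_insert (hee _ hs₂)] at h1
    have hU : insert w₁ π₁ = insert w₂ π₂ := by
      rw [← sdiff_sdiff_erase_eq hπ₁ hw₁X hw₁π, ← sdiff_sdiff_erase_eq hπ₂ hw₂X hw₂π, hρ]
    by_contra hne
    have hπne : π₁ ≠ π₂ := by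
      intro h'
      apply hne
      rw [← hWeq₁, ← hWeq₂, ← hYeq₁, ← hYeq₂]
      exact congrArg (fun S => insert b (insert e S)) h'
    -- `w₁ ∈ π₂`
    have hw₁π₂ : w₁ ∈ π₂ := by
      have : w₁ ∈ insert w₂ π₂ := hU ▸ mem_insert_self _ _
      rcases mem_insert.1 this with h' | h'
      · exfalso
        apply hπne
        have h2 : (insert w₁ π₁).erase w₁ = (insert w₂ π₂).erase w₁ := by rw [hU]
        rwa [erase_insert hw₁π, h', erase_insert hw₂π] at h2
      · exact h'
    -- the two `ef`-planes
    set S₁ := insert f (insert e π₁) with hS₁def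
    set S₂ := insert f (insert e π₂) with hS₂def
    have hS₁E : S₁ ⊆ ((gr N).erase b).erase b' := insert_subset hfE (insert_subset heE (hπ₁.trans hXE))
    have hS₂E : S₂ ⊆ ((gr N).erase b).erase b' := insert_subset hfE (insert_subset heE (hπ₂.trans hXE))
    have hS₁3 : rk N S₁ = 3 := rk_insert_ef_eq_three_of_not_c1 he hf hπ₁ hYr₁ hnc₁₁
    have hS₂3 : rk N S₂ = 3 := rk_insert_ef_eq_three_of_not_c1 he hf hπ₂ hYr₂ hnc₁₂
    have hon₁ : rk N (insert b (insert b' S₁)) = 4 :=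
      on_insert_of_rk_insert_eq (N := N) (Y := insert e π₁) (t := f) (by rw [hS₁3, hYr₁]) hYon₁
    have hon₂ : rk N (insert b (insert b' S₂)) = 4 :=
      on_insert_of_rk_insert_eq (N := N) (Y := insert e π₂) (t := f) (by rw [hS₂3, hYr₂]) hYon₂
    have hsub : insert w₁ (insert e π₁) ⊆ S₁ ∪ S₂ := by
      intro x hx
      rcases mem_insert.1 hx with rfl | hx
      · exact mem_union_right _ (mem_insert_of_mem (mem_insert_of_mem hw₁π₂))
      · exact mem_union_left _ (mem_insert_of_mem hx)
    have hU4 : rk N (S₁ ∪ S₂) = 4 := by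
      have h1 : rk N (insert w₁ (insert e π₁)) ≤ rk N (S₁ ∪ S₂) := rk_mono' (M := N) hsub
      have h2 : rk N (S₁ ∪ S₂) ≤ rk N (((gr N).erase b).erase b') := rk_mono' (M := N) (union_subset hS₁E hS₂E)
      omega
    have hI := rk_inter_le_one_of_two_on_e h hR hnle hS₁E hS₂E (mem_insert_of_mem (mem_insert_self _ _))
      (mem_insert_of_mem (mem_insert_self _ _)) hon₁ hon₂ hU4
    have hefI : ({e, f} : Finset α) ⊆ S₁ ∩ S₂ := by
      intro x hx
      simp only [mem_insert, mem_singleton] at hx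
      rcases hx with rfl | rfl
      · exact mem_inter.2 ⟨mem_insert_of_mem (mem_insert_self _ _), mem_insert_of_mem (mem_insert_self _ _)⟩
      · exact mem_inter.2 ⟨mem_insert_self _ _, mem_insert_self _ _⟩
    have := rk_mono' (M := N) hefI
    omega

/-- **RULE R2′ INTO ITS SUB-CLASS**: the bi-bases `π + e + f` of the R2′ demands have pair `π` an ON demand
(`d0_injR2'` with the refined target: the complement of the R4a′ sub-class inside the bi-basis kind). -/
theorem d0_injR2'' (hn : (gr N).card = 9) (h : SeriesPair N b b')
    {e f : α} (he : e ∈ gr N) (hf : f ∈ gr N) (hef : e ≠ f) (heb : e ≠ b) (heb' : e ≠ b') (hfb : f ≠ b) (hfb' : f ≠ b') :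
    ((d0DON N b' e f).filter (fun W => (¬ d0c0 N b b' e f W ∧ d0c1 N b e f W) ∧ d0c2 N b b' e f W)).card ≤
      ((biIndepSets N 4).filter (fun B => ((f ∈ B ∧ b' ∉ B) ∧ (e ∈ B ∧ b ∉ B)) ∧
        (insert b (B.erase f) ∈ biIndepSets N 4 ∧ rk N (insert b (insert b' (B.erase f))) = 4))).card := by
  have hXE : ((((gr N).erase b).erase b').erase f).erase e ⊆ ((gr N).erase b).erase b' := (erase_subset _ _).trans (erase_subset _ _)
  have heE : e ∈ ((gr N).erase b).erase b' := mem_erase.2 ⟨heb', mem_erase.2 ⟨heb, he⟩⟩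
  have hfE : f ∈ ((gr N).erase b).erase b' := mem_erase.2 ⟨hfb', mem_erase.2 ⟨hfb, hf⟩⟩
  have heX : e ∉ ((((gr N).erase b).erase b').erase f).erase e := fun h' => (mem_erase.1 h').1 rfl
  have hfX : f ∉ ((((gr N).erase b).erase b').erase f).erase e := fun h' => (mem_erase.1 (mem_erase.1 h').2).1 rfl
  have hdata := d0_demand_data h hn hf hef heb hfb hfb' (e := e)
  apply card_le_card_of_injOn (fun W => insert f (W.erase b))
  · intro W hW
    simp only [d0DON, mem_coe, mem_filter] at hW
    obtain ⟨⟨hWs, hPD, hcW⟩, ⟨-, hc1⟩, hc₂⟩ := hW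
    obtain ⟨hbW, hπX, hπ2, hYeq, hWeq, hYr, hYc, hYon⟩ := hdata W hWs hPD hcW
    have hYE : insert e ((W.erase b).erase e) ⊆ ((gr N).erase b).erase b' := insert_subset heE (hπX.trans hXE)
    have hf4 : rk N (insert f (insert e ((W.erase b).erase e))) = 4 := hc1
    have hfπ : f ∉ (W.erase b).erase e := fun h' => hfX (hπX h')
    have heπ : e ∉ (W.erase b).erase e := fun h' => heX (hπX h')
    have hfW : f ∉ W.erase b := fun h' => hPD.1.2 (mem_of_mem_erase h')
    have hWE : insert f (W.erase b) ⊆ ((gr N).erase b).erase b' := by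
      rw [← hYeq]; exact insert_subset hfE hYE
    have hW4 : (insert f (W.erase b)).card = 4 := by
      rw [← hYeq, card_insert_of_notMem, card_insert_of_notMem heπ, hπ2]
      simp only [mem_insert, not_or]; exact ⟨hef.symm, hfπ⟩
    simp only [mem_coe, mem_filter]
    refine ⟨?_, ⟨⟨mem_insert_self _ _, ?_⟩, mem_insert_of_mem (mem_erase.2 ⟨heb, hPD.1.1⟩), ?_⟩, ?_⟩
    · rw [mem_biIndepSets_iff_of_subset_E7 h hn hWE hW4, ← hYeq, E7_sdiff_insert_ef_eq]
      exact ⟨hf4, hc₂⟩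
    · intro h'
      rcases mem_insert.1 h' with h2 | h2
      · exact hfb' h2.symm
      · exact hPD.2 (mem_of_mem_erase h2)
    · intro h'
      rcases mem_insert.1 h' with h2 | h2
      · exact hfb h2.symm
      · exact (mem_erase.1 h2).1 rfl
    · rw [erase_insert hfW, hWeq, ← hYeq]
      exact ⟨hWeq ▸ hWs, hYon⟩
  · intro W₁ hW₁ W₂ hW₂ heq
    simp only [d0DON, mem_coe, mem_filter] at hW₁ hW₂
    obtain ⟨hb₁, -, -, -, -, -, -, -⟩ := hdata W₁ hW₁.1.1 hW₁.1.2.1 hW₁.1.2.2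
    obtain ⟨hb₂, -, -, -, -, -, -, -⟩ := hdata W₂ hW₂.1.1 hW₂.1.2.1 hW₂.1.2.2
    have hfW₁ : f ∉ W₁.erase b := fun h' => hW₁.1.2.1.1.2 (mem_of_mem_erase h')
    have hfW₂ : f ∉ W₂.erase b := fun h' => hW₂.1.2.1.1.2 (mem_of_mem_erase h')
    have h1 : (insert f (W₁.erase b)).erase f = (insert f (W₂.erase b)).erase f := by
      have heq' : insert f (W₁.erase b) = insert f (W₂.erase b) := heq
      rw [heq']
    rw [erase_insert hfW₁, erase_insert hfW₂] at h1
    rw [← insert_erase hb₁, ← insert_erase hb₂, h1]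

end StarSharpD0Q

end PercRepro.Cogirth
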